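import Summits.CriticalPhenomena.PercolationContinuityZ3.Theorems.Transplant.Slab111HubTab3
import HarnessLib

/-!
# The HUB ROUTING of the `(111)`-films, XXIV: the table checker v4 — the CLASS RULE for tight pairs

builds on p205010 (kernel theorem, internal audit signed; external expert review pending) — NOT used in this file.  Lane `prim-bschramm`, seat
`prim-bschramm-p2` (gen 36; class C1b; memo `HOME/bschramm/P2-LATTICES.md` §131); helper file (`--supports stmt-CriticalPhenomena-4575 --as helper`).
«Slab111HubTab3».`tab3OK` with one more realisability rule: for a TIGHT pair (`|τ| ≤ 6`) the level difference `τ = nJ − nI` is congruent mod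
`3` to the class difference of the columns (both terminals are film vertices: `3 ∣ n − c₀ − (q.1 + 2q.2)`), `classOKB`.  This removes two thirds
of the tight patterns.  `keyCover4B`, `tab4OK`, soundness `tab4OK_sound` (extra hypotheses `classOKB` for the realised pairs).
[cite: DuminilCopinSidoraviciusTassion2016, §2.3 (proof of Fact 2: the three disjoint paths γ_u, γ_v, γ_w in B_R(z))]
-/

namespace Summit.CriticalPhenomena.PercolationContinuityZ3.Theorems.Transplant

namespace Slab111

/-- **The class rule**: far, or `τ ≡ class(qJ) − class(qI) (mod 3)`. [folklore] -/
def classOKB (qI qJ : ℤ × ℤ) (τ : ℤ) : Bool :=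
  (τ == 7) || (τ == -7) || ((τ - ((qJ.1 + 2 * qJ.2) - (qI.1 + 2 * qI.2))) % 3 == 0)

/-- A triple implication guard (left-associated `||`). [folklore] -/
theorem of_guardB4 {a b c d : Bool} (h : (((!a || !b) || !c) || d) = true) (ha : a = true) (hb : b = true) (hc : c = true) : d = true := by
  rw [ha, hb, hc] at h; simpa using h

/-- **COVER CHECK OF ONE KEY, v4 (with the class rule)**: every pattern passing the shape's flag filter `filt` (what `Terminals` and the cleared set allow) and the
level rules lies in the box of some base-valid candidate. [folklore] -/
def keyCover4B (pcB wcB : ℤ × ℤ → Bool) (badB : ℤ → ℤ × ℤ → Bool) (filt : ℕ → ℕ → ℕ → Bool) (q₁ q₂ q₃ : ℤ × ℤ) (d₁ d₂ d₃ : ℤ)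
    (cands : List ℕ) : Bool :=
  let boxes := (cands.map fun c => entryOf3 c d₁ d₂ d₃).filterMap fun e =>
    if e.baseB pcB wcB q₁ q₂ q₃ d₁ d₂ d₃ 3 then some (boxOf badB e q₁ q₂ q₃ d₁ d₂ d₃) else none
  let s12 := q₁ == q₂
  let s13 := q₁ == q₃
  let s23 := q₂ == q₃
  boxes.any fullBox ||
  (List.range 3).all fun β₁ => (List.range 3).all fun β₂ => (List.range 3).all fun β₃ => !filt β₁ β₂ β₃ ||
      if d₁ = d₂ ∧ d₁ = d₃ then
        TAUS.all fun τ12 => !pairRuleB β₁ β₂ τ12 d₁ s12 || !classOKB q₁ q₂ τ12 || TAUS.all fun τ23 => !pairRuleB β₂ β₃ τ23 d₁ s23 ||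
          !classOKB q₂ q₃ τ23 || TAUS.all fun τ13 => !pairRuleB β₁ β₃ τ13 d₁ s13 || !classOKB q₁ q₃ τ13 || !maybeB τ12 τ13 τ23 ||
            boxes.any fun b => inBox b β₁ β₂ β₃ τ12 τ13 τ23
      else if d₁ = d₂ then TAUS.all fun τ => !pairRuleB β₁ β₂ τ d₁ s12 || !classOKB q₁ q₂ τ || boxes.any fun b => inBox b β₁ β₂ β₃ τ 0 0
      else if d₁ = d₃ then TAUS.all fun τ => !pairRuleB β₁ β₃ τ d₁ s13 || !classOKB q₁ q₃ τ || boxes.any fun b => inBox b β₁ β₂ β₃ 0 τ 0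
      else TAUS.all fun τ => !pairRuleB β₂ β₃ τ d₂ s23 || !classOKB q₂ q₃ τ || boxes.any fun b => inBox b β₁ β₂ β₃ 0 0 τ

/-- **THE TABLE CHECKER v4** for fixed `(q₁, q₂)` and a shape (region predicates `pcB, wcB`, boundary-missing columns `badB`, flag filter
`filtOf`): every `q₃ ∈ cols ∖ {hub, q₁, q₂}` and every side triple pass `keyCoverB` with the candidates of `(A, C)`. [folklore] -/
def tab4OK (pcB wcB : ℤ × ℤ → Bool) (badB : ℤ → ℤ × ℤ → Bool) (filtOf : ℤ × ℤ → ℤ × ℤ → ℤ × ℤ → ℤ → ℤ → ℤ → ℕ → ℕ → ℕ → Bool)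
    (cols : List (ℤ × ℤ)) (q₁ q₂ : ℤ × ℤ) (A C : ℕ) : Bool :=
  (List.range cols.length).all fun i₃ =>
    let q₃ := (cols[i₃]?).getD (0, 0)
    q₃ == (0, 0) || q₃ == q₁ || q₃ == q₂ ||
      (List.range 8).all fun idir =>
        let d := dirsOf idir
        keyCover4B pcB wcB badB (filtOf q₁ q₂ q₃ d.1 d.2.1 d.2.2) q₁ q₂ q₃ d.1 d.2.1 d.2.2 (candsOf A C i₃ idir)

/-! ## Soundness -/

/-- **SOUNDNESS OF THE COVER CHECK OF ONE KEY.** [folklore] -/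
theorem keyCover4B_sound {pcB wcB : ℤ × ℤ → Bool} {badB : ℤ → ℤ × ℤ → Bool} {filt : ℕ → ℕ → ℕ → Bool} {q₁ q₂ q₃ : ℤ × ℤ} {d₁ d₂ d₃ : ℤ}
    {cands : List ℕ} (h : keyCover4B pcB wcB badB filt q₁ q₂ q₃ d₁ d₂ d₃ cands = true)
    (hd₁ : d₁ = 1 ∨ d₁ = -1) (hd₂ : d₂ = 1 ∨ d₂ = -1) (hd₃ : d₃ = 1 ∨ d₃ = -1)
    {β₁ β₂ β₃ : ℕ} (hb₁ : β₁ < 3) (hb₂ : β₂ < 3) (hb₃ : β₃ < 3) (hfilt : filt β₁ β₂ β₃ = true)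
    {τ12 τ13 τ23 : ℤ} (hτ12 : τ12 ∈ TAUS) (hτ13 : τ13 ∈ TAUS) (hτ23 : τ23 ∈ TAUS)
    (r12 : d₁ = d₂ → pairRuleB β₁ β₂ τ12 d₁ (q₁ == q₂) = true) (r13 : d₁ = d₃ → pairRuleB β₁ β₃ τ13 d₁ (q₁ == q₃) = true)
    (r23 : d₂ = d₃ → pairRuleB β₂ β₃ τ23 d₂ (q₂ == q₃) = true) (rtri : d₁ = d₂ → d₁ = d₃ → maybeB τ12 τ13 τ23 = true)
    (c12 : d₁ = d₂ → classOKB q₁ q₂ τ12 = true) (c13 : d₁ = d₃ → classOKB q₁ q₃ τ13 = true) (c23 : d₂ = d₃ → classOKB q₂ q₃ τ23 = true) :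
    ∃ e : Entry, e.baseB pcB wcB q₁ q₂ q₃ d₁ d₂ d₃ 3 = true ∧
      accB e.l₁ q₁ d₁ β₁ (badB d₁) = true ∧ accB e.l₂ q₂ d₂ β₂ (badB d₂) = true ∧ accB e.l₃ q₃ d₃ β₃ (badB d₃) = true ∧
      (d₁ = d₂ → pairOKB e.l₁ e.l₂ q₁ q₂ e.F1 e.F2 d₁ τ12 = true) ∧ (d₁ = d₃ → pairOKB e.l₁ e.l₃ q₁ q₃ e.F1 e.F3 d₁ τ13 = true) ∧
      (d₂ = d₃ → pairOKB e.l₂ e.l₃ q₂ q₃ e.F2 e.F3 d₂ τ23 = true) := by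
  unfold keyCover4B at h
  dsimp only at h
  rw [Bool.or_eq_true] at h
  -- a helper turning a found box into the conclusion (used by the shortcut and by the loops)
  have finish0 : ∀ {t12 t13 t23 : ℤ}, t12 ∈ TAUS → t13 ∈ TAUS → t23 ∈ TAUS → (d₁ = d₂ → t12 = τ12) → (d₁ = d₃ → t13 = τ13) →
      (d₂ = d₃ → t23 = τ23) → ∀ e : Entry, e.baseB pcB wcB q₁ q₂ q₃ d₁ d₂ d₃ 3 = true →
      inBox (boxOf badB e q₁ q₂ q₃ d₁ d₂ d₃) β₁ β₂ β₃ t12 t13 t23 = true →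
      ∃ e : Entry, e.baseB pcB wcB q₁ q₂ q₃ d₁ d₂ d₃ 3 = true ∧
        accB e.l₁ q₁ d₁ β₁ (badB d₁) = true ∧ accB e.l₂ q₂ d₂ β₂ (badB d₂) = true ∧ accB e.l₃ q₃ d₃ β₃ (badB d₃) = true ∧
        (d₁ = d₂ → pairOKB e.l₁ e.l₂ q₁ q₂ e.F1 e.F2 d₁ τ12 = true) ∧ (d₁ = d₃ → pairOKB e.l₁ e.l₃ q₁ q₃ e.F1 e.F3 d₁ τ13 = true) ∧
        (d₂ = d₃ → pairOKB e.l₂ e.l₃ q₂ q₃ e.F2 e.F3 d₂ τ23 = true) := by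
    intro t12 t13 t23 m12 m13 m23 e12 e13 e23 e hbase hin
    obtain ⟨a1, a2, a3, p12, p13, p23⟩ := inBox_sound hin m12 m13 m23
    exact ⟨e, hbase, a1, a2, a3, fun hd => e12 hd ▸ p12 hd, fun hd => e13 hd ▸ p13 hd, fun hd => e23 hd ▸ p23 hd⟩
  rcases h with hfull | h
  · -- a candidate with a FULL box accepts the given pattern
    rw [List.any_eq_true] at hfull
    obtain ⟨b, hb, hfb⟩ := hfull
    rw [List.mem_filterMap] at hb
    obtain ⟨e, -, he⟩ := hb
    by_cases hbase : e.baseB pcB wcB q₁ q₂ q₃ d₁ d₂ d₃ 3 = true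
    · rw [if_pos hbase] at he
      have hbe : b = boxOf badB e q₁ q₂ q₃ d₁ d₂ d₃ := (Option.some.inj he).symm
      refine finish0 hτ12 hτ13 hτ23 (fun _ => rfl) (fun _ => rfl) (fun _ => rfl) e hbase ?_
      rw [← hbe]
      obtain ⟨l12, u12⟩ := TAUS_bounds hτ12; obtain ⟨l13, u13⟩ := TAUS_bounds hτ13; obtain ⟨l23, u23⟩ := TAUS_bounds hτ23
      have hlen : b.1.length = 3 ∧ b.2.1.length = 3 ∧ b.2.2.1.length = 3 ∧ b.2.2.2.1.length = 15 ∧ b.2.2.2.2.1.length = 15 ∧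
          b.2.2.2.2.2.length = 15 := by
        rw [hbe]; unfold boxOf; simp [TAUS]
      unfold fullBox at hfb
      simp only [Bool.and_eq_true, List.all_eq_true, id] at hfb
      obtain ⟨⟨⟨⟨⟨f1, f2⟩, f3⟩, f4⟩, f5⟩, f6⟩ := hfb
      have get : ∀ {l : List Bool} {i : ℕ}, (∀ x ∈ l, x = true) → i < l.length → l.getD i false = true := by
        intro l i hl hi
        rw [List.getD_eq_getElem?_getD, List.getElem?_eq_getElem hi, Option.getD_some]
        exact hl _ (List.getElem_mem hi)
      unfold inBox
      simp only [Bool.and_eq_true]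
      exact ⟨⟨⟨⟨⟨get f1 (by omega), get f2 (by omega)⟩, get f3 (by omega)⟩, get f4 (by omega)⟩, get f5 (by omega)⟩, get f6 (by omega)⟩
    · rw [if_neg hbase] at he; exact absurd he (by simp)
  -- peel the flag loops and the filter guard
  have g1 := all_range_get h hb₁
  have g2 := all_range_get g1 hb₂
  have g3 := of_guardB (all_range_get g2 hb₃) hfilt
  -- a helper turning a found box into the conclusion
  have finish : ∀ {t12 t13 t23 : ℤ}, t12 ∈ TAUS → t13 ∈ TAUS → t23 ∈ TAUS → (d₁ = d₂ → t12 = τ12) → (d₁ = d₃ → t13 = τ13) →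
      (d₂ = d₃ → t23 = τ23) →
      (((cands.map fun c => entryOf3 c d₁ d₂ d₃).filterMap fun e =>
        if e.baseB pcB wcB q₁ q₂ q₃ d₁ d₂ d₃ 3 then some (boxOf badB e q₁ q₂ q₃ d₁ d₂ d₃) else none).any
          fun b => inBox b β₁ β₂ β₃ t12 t13 t23) = true →
      ∃ e : Entry, e.baseB pcB wcB q₁ q₂ q₃ d₁ d₂ d₃ 3 = true ∧
        accB e.l₁ q₁ d₁ β₁ (badB d₁) = true ∧ accB e.l₂ q₂ d₂ β₂ (badB d₂) = true ∧ accB e.l₃ q₃ d₃ β₃ (badB d₃) = true ∧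
        (d₁ = d₂ → pairOKB e.l₁ e.l₂ q₁ q₂ e.F1 e.F2 d₁ τ12 = true) ∧ (d₁ = d₃ → pairOKB e.l₁ e.l₃ q₁ q₃ e.F1 e.F3 d₁ τ13 = true) ∧
        (d₂ = d₃ → pairOKB e.l₂ e.l₃ q₂ q₃ e.F2 e.F3 d₂ τ23 = true) := by
    intro t12 t13 t23 m12 m13 m23 e12 e13 e23 hany
    obtain ⟨e, hbase, hin⟩ := any_boxes_sound hany
    obtain ⟨a1, a2, a3, p12, p13, p23⟩ := inBox_sound hin m12 m13 m23
    exact ⟨e, hbase, a1, a2, a3, fun hd => e12 hd ▸ p12 hd, fun hd => e13 hd ▸ p13 hd, fun hd => e23 hd ▸ p23 hd⟩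
  have z : (0 : ℤ) ∈ TAUS := by decide
  by_cases hall : d₁ = d₂ ∧ d₁ = d₃
  · rw [if_pos hall] at g3
    have h23d : d₂ = d₃ := hall.1.symm.trans hall.2
    have a := of_guardB2 (all_TAUS_get g3 hτ12) (r12 hall.1) (c12 hall.1)
    have b := of_guardB2 (all_TAUS_get a hτ23) (by rw [hall.1]; exact r23 h23d) (c23 h23d)
    have c := of_guardB4 (all_TAUS_get b hτ13) (r13 hall.2) (c13 hall.2) (rtri hall.1 hall.2)
    exact finish hτ12 hτ13 hτ23 (fun _ => rfl) (fun _ => rfl) (fun _ => rfl) c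
  · rw [if_neg hall] at g3
    by_cases h12 : d₁ = d₂
    · rw [if_pos h12] at g3
      have h13 : d₁ ≠ d₃ := fun e => hall ⟨h12, e⟩
      have h23 : d₂ ≠ d₃ := fun e => h13 (h12.trans e)
      have a := of_guardB2 (all_TAUS_get g3 hτ12) (r12 h12) (c12 h12)
      exact finish hτ12 z z (fun _ => rfl) (fun e => absurd e h13) (fun e => absurd e h23) a
    · rw [if_neg h12] at g3
      by_cases h13 : d₁ = d₃
      · rw [if_pos h13] at g3
        have h23 : d₂ ≠ d₃ := fun e => h12 (h13.trans e.symm)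
        have a := of_guardB2 (all_TAUS_get g3 hτ13) (r13 h13) (c13 h13)
        exact finish z hτ13 z (fun e => absurd e h12) (fun _ => rfl) (fun e => absurd e h23) a
      · rw [if_neg h13] at g3
        have h23 : d₂ = d₃ := by
          rcases hd₁ with e1 | e1 <;> rcases hd₂ with e2 | e2 <;> rcases hd₃ with e3 | e3 <;> subst e1 <;> subst e2 <;> subst e3 <;>
            simp_all
        have a := of_guardB2 (all_TAUS_get g3 hτ23) (r23 h23) (c23 h23)
        exact finish z z hτ23 (fun e => absurd e h12) (fun e => absurd e h13) (fun _ => rfl) a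

/-- **SOUNDNESS OF THE TABLE CHECKER v3.** [folklore] -/
theorem tab4OK_sound {pcB wcB : ℤ × ℤ → Bool} {badB : ℤ → ℤ × ℤ → Bool}
    {filtOf : ℤ × ℤ → ℤ × ℤ → ℤ × ℤ → ℤ → ℤ → ℤ → ℕ → ℕ → ℕ → Bool} {cols : List (ℤ × ℤ)} {q₁ q₂ : ℤ × ℤ} {A C : ℕ}
    (h : tab4OK pcB wcB badB filtOf cols q₁ q₂ A C = true)
    {q₃ : ℤ × ℤ} (hq₃ : q₃ ∈ cols) (h0 : q₃ ≠ (0, 0)) (h1 : q₃ ≠ q₁) (h2 : q₃ ≠ q₂)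
    {d₁ d₂ d₃ : ℤ} (hd₁ : d₁ = 1 ∨ d₁ = -1) (hd₂ : d₂ = 1 ∨ d₂ = -1) (hd₃ : d₃ = 1 ∨ d₃ = -1)
    {β₁ β₂ β₃ : ℕ} (hb₁ : β₁ < 3) (hb₂ : β₂ < 3) (hb₃ : β₃ < 3) (hfilt : filtOf q₁ q₂ q₃ d₁ d₂ d₃ β₁ β₂ β₃ = true)
    {τ12 τ13 τ23 : ℤ} (hτ12 : τ12 ∈ TAUS) (hτ13 : τ13 ∈ TAUS) (hτ23 : τ23 ∈ TAUS)
    (r12 : d₁ = d₂ → pairRuleB β₁ β₂ τ12 d₁ (q₁ == q₂) = true) (r13 : d₁ = d₃ → pairRuleB β₁ β₃ τ13 d₁ (q₁ == q₃) = true)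
    (r23 : d₂ = d₃ → pairRuleB β₂ β₃ τ23 d₂ (q₂ == q₃) = true) (rtri : d₁ = d₂ → d₁ = d₃ → maybeB τ12 τ13 τ23 = true)
    (c12 : d₁ = d₂ → classOKB q₁ q₂ τ12 = true) (c13 : d₁ = d₃ → classOKB q₁ q₃ τ13 = true) (c23 : d₂ = d₃ → classOKB q₂ q₃ τ23 = true) :
    ∃ e : Entry, e.baseB pcB wcB q₁ q₂ q₃ d₁ d₂ d₃ 3 = true ∧
      accB e.l₁ q₁ d₁ β₁ (badB d₁) = true ∧ accB e.l₂ q₂ d₂ β₂ (badB d₂) = true ∧ accB e.l₃ q₃ d₃ β₃ (badB d₃) = true ∧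
      (d₁ = d₂ → pairOKB e.l₁ e.l₂ q₁ q₂ e.F1 e.F2 d₁ τ12 = true) ∧ (d₁ = d₃ → pairOKB e.l₁ e.l₃ q₁ q₃ e.F1 e.F3 d₁ τ13 = true) ∧
      (d₂ = d₃ → pairOKB e.l₂ e.l₃ q₂ q₃ e.F2 e.F3 d₂ τ23 = true) := by
  obtain ⟨i₃, hi₃, hget⟩ := exists_index_of_mem hq₃
  obtain ⟨hdirs, hlt⟩ := dirsOf_idirOf hd₁ hd₂ hd₃
  unfold tab4OK at h
  have hrow := all_range_get h hi₃
  simp only [hget] at hrow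
  rw [Bool.or_eq_true, Bool.or_eq_true, Bool.or_eq_true, beq_iff_eq, beq_iff_eq, beq_iff_eq] at hrow
  rcases hrow with ((e | e) | e) | hrow
  · exact absurd e h0
  · exact absurd e h1
  · exact absurd e h2
  have hk := all_range_get hrow hlt
  simp only [hdirs] at hk
  exact keyCover4B_sound hk hd₁ hd₂ hd₃ hb₁ hb₂ hb₃ hfilt hτ12 hτ13 hτ23 r12 r13 r23 rtri c12 c13 c23

end Slab111

end Summit.CriticalPhenomena.PercolationContinuityZ3.Theorems.Transplant
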